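import Summits.ValiantsHypothesis.ValiantsHypothesis.Theorems.LacunarySymmetroidMatrixDescartesCensusM4K8CH66C1
import Summits.ValiantsHypothesis.ValiantsHypothesis.Theorems.LacunarySymmetroidMatrixDescartesCensusM4K8CH66C2
import Summits.ValiantsHypothesis.ValiantsHypothesis.Theorems.LacunarySymmetroidMatrixDescartesCensusM4K8CH66C3

/-!
# `MatrixDescartes` census certificate `M4K8CH66` (by reflection, 3 chunks): format `(m, K) = (4, 8)`, `66 ≤ Z₊` — hence `ζ_sym(4,8) ≥ 66`

HONEST FRAMING.  Generated by `reflect_row.py --chunks 3` (val-V1-extremal engine seat val-v1x-eng-10) from ONE census witness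
record; it certifies in the kernel only `¬ PosRootLawAt 4 8 65` (≥ 66 distinct positive determinant roots of the explicit
integer symmetric pencil written in the chunk files `…LacunarySymmetroidMatrixDescartesCensusM4K8CH66C1 … C3`).  Each chunk file proves, by ONE kernel computation
(`decide +kernel`, kit `…CensusReflectChunks :: chunkCheck`), that its share of the 67 rational test points is positive, strictly
increasing and carries strictly alternating exact determinant signs; consecutive chunks share their junction point; this file
glues the localised root counts (`le_card_Ioo_of_chunkCheck`, `card_filter_Ioo_add_le`) and checks symmetry (`symmB`).
Nothing is claimed about the asymptotic crux `Theses.LacunarySymmetroid.MatrixDescartes` (stmt-ValiantsHypothesis-18050)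
nor about `VP ≠ VNP`.

Source record: `E10G0-CHAIN66s-4-8` (val-v1x-eng-10 chain.py junction of val-v1x-eng-1 E1V1X-CAPF30 (4,4)=30 with val-v1x-eng-8 E8G0-FLAGCAP36 (4,5)=36); exponents `d = (0, 3, 4, 623, 1242, 1245, 1246, 1502)`; integer entries up to
7860 digits; data sha256/16 `8f52a5b947ba7bb4`; 67 points, exact `det` signs `-+-+-+-+-+-+-+-+-+-+-+-+-+-+-+-+-+-+-+-+-+-+-+-+-+-+-+-+-+-+-+-+-+-`; chunks: 22 roots, 22 roots, 22 roots.
Context: `D(4,8) = 329`, `P(4,8) = 64`.  Generated 2026-08-28T18:18Z.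
[folklore] Descartes / intermediate value theorem; certificate by kernel reflection.
-/

-- `Summit.ValiantsHypothesis.ValiantsHypothesis.…` repeats a component by the D-0017 layout
-- (single-conjunct summit), which the `dupNamespace` linter flags; the name is mandated.
set_option linter.dupNamespace false

namespace Summit.ValiantsHypothesis.ValiantsHypothesis.Theorems.LacunarySymmetroidMatrixDescartes.Census.Reflect

open Summit.ValiantsHypothesis.ValiantsHypothesis.Theorems.MatrixDescartes.Negative (PosRootLawAt)

set_option maxHeartbeats 4000000 in
set_option maxRecDepth 16384 in
/-- **`ζ_sym(4,8) ≥ 66`** (record `E10G0-CHAIN66s-4-8`), assembled from 3 kernel-checked chunks. [folklore] -/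
theorem chain66_not_posRootLawAt_4_8_65 : ¬ PosRootLawAt 4 8 65 := by
  have h1 := le_card_Ioo_of_chunkCheck chain66_not_posRootLawAt_4_8_65_c1
  have l1 := ptR_lt_of_chunkCheck chain66_not_posRootLawAt_4_8_65_c1
  have h2 := le_card_Ioo_of_chunkCheck chain66_not_posRootLawAt_4_8_65_c2
  have l2 := ptR_lt_of_chunkCheck chain66_not_posRootLawAt_4_8_65_c2
  have g2 := (Nat.add_le_add h1 h2).trans (card_filter_Ioo_add_le _ l1.le l2.le)
  have m2 := l1.trans l2
  have h3 := le_card_Ioo_of_chunkCheck chain66_not_posRootLawAt_4_8_65_c3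
  have l3 := ptR_lt_of_chunkCheck chain66_not_posRootLawAt_4_8_65_c3
  have g3 := (Nat.add_le_add g2 h3).trans (card_filter_Ioo_add_le _ m2.le l3.le)
  exact not_posRootLawAt_of_le_card_Ioo (by decide +kernel) (ptR_pos_of_chunkCheck chain66_not_posRootLawAt_4_8_65_c1).le g3 (by norm_num)

end Summit.ValiantsHypothesis.ValiantsHypothesis.Theorems.LacunarySymmetroidMatrixDescartes.Census.Reflect
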